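import Summits.KontsevichZagierPeriods.KontsevichZagierPeriods.Theorems.RootDecompWalshStrataConicSector

/-!
# Root decomposition (Walsh strata), part 61 — E-type corners: the thin conic-wall strata (gen 10, §61)

Route `RootDecompWalshStrata`, leaf `QuadricBakerDescent` (stmt-27597), residual R-Eθ (NODE.md, decomp-kz-lens-4,
GEN 10 MENU (1)).  The conic-wall section terminal `InBaker.psection_cwall` (§39) excludes three thin strata of
adapted conic walls `a(κ₀X² + κ₁Y²) + c = (q₀ + q₁X + q₂Y)²` of an E-type sector (`κ₀, κ₁ > 0`); in the SLOPE
CHART `(X, Y) = (ζ/N(t), ζt/N(t))` every one of them is elementary: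

* `InBaker.psection_hpair` — the horizontal pair `aκ₀ = q₁²`, `q₀ = q₂ = 0`: the wall is `aκ₁Y² + c = 0`;
  `c > 0`: empty; `c = 0`: the null slope `t = 0`; `c < 0`: `aζ² + c = M/t²` with `M = −cκ₀/κ₁ > 0`, so the
  primitive is `√M·(γM/3a)/(t³W(t))` — the landed scaled rational class `InBaker.sqrt_const_LW`;
* `InBaker.psection_centre` — the centre lies on the wall conic (`q₀² = c`): the wall is RATIONALLY
  parametrised by the slope, `X = 2q₀u/(aW − u²)`, `u = q₁ + q₂t`, the affine form is `Λ = q₀(aW + u²)/(aW − u²)`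
  and the primitive `γ/(3a)·Λ²|Λ|/W` is rational after the sign split (`InBaker.abs_of_signed`,
  `InBaker.of_isRatOn`); `q₀ = 0`: the section lies on the null set `aW(t) = u(t)²`;
* (part 62) `InBaker.psection_dpoint` — double-root radicand off the centre: the wall conic is ONE POINT, the
  section is null — and the total dispatcher `InBaker.psection_cwall'`.

[KontsevichZagier2001 §1.2 rules (1)–(3); BCR1998 §2.2; this node]
-/

noncomputable section

open Set MeasureTheory MvPolynomial Literature.NumberTheory.Transcendental
open Literature.ModelTheory.ExponentialFields (IsSemialgebraic)

namespace Summit.KontsevichZagierPeriods.RootDecompWalshStrata.ConicDescent.BallCube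

variable {κ₀ κ₁ : ℚ}

/-! #### 61.1 The horizontal pair `aκ₀ = q₁²`, `q₀ = q₂ = 0` -/

/-- **HORIZONTAL PAIR.**  On the stratum `aκ₀ = q₁²`, `q₀ = q₂ = 0` the wall reads `aκ₁ζ²t² + cW(t) = 0`:
empty for `c > 0`, the null slope `t = 0` for `c = 0`, and for `c < 0` the radicand is `aζ² + c = M/t²`
(`M = −cκ₀/κ₁`), so the primitive `√M·(γM/3a)/(t³W)` is in the scaled rational class `InBaker.sqrt_const_LW`.
[KontsevichZagier2001 §1.2; this node] -/
theorem InBaker.psection_hpair (hκ : 0 < κ₀ ∧ 0 < κ₁) (γ a c : ℚ) (ha : a ≠ 0) (q : Wall)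
    (hk : a * κ₀ - q.k1 ^ 2 = 0) (h0 : q.k0 = 0) (h2 : q.k2 = 0)
    {S : Set (Fin 1 → ℝ)} (ζ : (Fin 1 → ℝ) → ℝ) (hS01 : ∀ x ∈ S, 0 ≤ x 0 ∧ x 0 ≤ 1)
    (hζ : ∀ x ∈ S, 0 < ζ x ∧ ζ x ^ 2 ≤ 1)
    (hwall : ∀ x ∈ S, (a : ℝ) * ζ x ^ 2 + c =
      (q.k0 + (q.k1 + q.k2 * x 0) * (ζ x / pN κ₀ κ₁ (x 0))) ^ 2)
    (r₁ : KZ.IntegralRep 1) (hr₁ : r₁.domain ⊆ S)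
    (hint : EqOn r₁.integrand (fun x => ppot κ₀ κ₁ γ a c (Fin.snoc x (ζ x))) r₁.domain) :
    InBaker (KZ.of r₁) := by
  have hκ' : 0 < κ₀ ∧ 0 ≤ κ₁ := ⟨hκ.1, hκ.2.le⟩
  have hκ0 : (0 : ℝ) < κ₀ := by exact_mod_cast hκ.1
  have hκ1 : (0 : ℝ) < κ₁ := by exact_mod_cast hκ.2
  have ha' : (a : ℝ) ≠ 0 := by exact_mod_cast ha
  have s0 : ∀ (x : Fin 1 → ℝ) (t : ℝ), (Fin.snoc x t : Fin 2 → ℝ) 0 = x 0 := fun _ _ => rfl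
  have s1 : ∀ (x : Fin 1 → ℝ) (t : ℝ), (Fin.snoc x t : Fin 2 → ℝ) 1 = t := fun _ _ => rfl
  -- `aκ₀ = q₁²`, hence `a > 0`
  have hak : (a : ℝ) * κ₀ = (q.k1 : ℝ) ^ 2 := by
    have h : a * κ₀ = q.k1 ^ 2 := by linarith
    exact_mod_cast h
  have hapos : (0 : ℝ) < a := by
    rcases lt_or_gt_of_ne ha' with h | h
    · exfalso
      have h1 : (a : ℝ) * κ₀ < 0 := mul_neg_of_neg_of_pos h hκ0
      rw [hak] at h1
      linarith [sq_nonneg (q.k1 : ℝ)]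
    · exact h
  have haq : 0 < a := by exact_mod_cast hapos
  -- the wall relation `aκ₁ζ²t² + cW(t) = 0`
  have hrel : ∀ x ∈ S, (a : ℝ) * κ₁ * ζ x ^ 2 * x 0 ^ 2 + c * (κ₀ + κ₁ * x 0 ^ 2) = 0 := by
    intro x hx
    have hN := pN_pos hκ' (x 0)
    have hN2 := pN_sq hκ' (x 0)
    have hw := hwall x hx
    simp only [h0, h2, Rat.cast_zero, zero_mul, add_zero, zero_add] at hw
    have hw' : ((a : ℝ) * ζ x ^ 2 + c) * pN κ₀ κ₁ (x 0) ^ 2 = (q.k1 : ℝ) ^ 2 * ζ x ^ 2 := by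
      rw [hw, mul_pow, div_pow]
      field_simp
    rw [hN2, ← hak] at hw'
    linear_combination hw'
  rcases lt_trichotomy c 0 with hc | hc | hc
  · -- `c < 0`: the scaled rational class
    have hc' : (c : ℝ) < 0 := by exact_mod_cast hc
    have hnc : 0 < -c := neg_pos.2 hc
    have hMpos : 0 < -c * κ₀ / κ₁ := div_pos (mul_pos hnc hκ.1) hκ.2
    obtain ⟨τ, hτ⟩ : ∃ τ : ℚ, τ = -c * κ₀ / (a * κ₁) := ⟨_, rfl⟩
    have hτpos : 0 < τ := by rw [hτ]; exact div_pos (mul_pos hnc hκ.1) (mul_pos haq hκ.2)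
    obtain ⟨lo, hlo⟩ : ∃ lo : ℚ, lo = τ / (τ + 1) := ⟨_, rfl⟩
    have hlopos : 0 < lo := by rw [hlo]; positivity
    have hlo2 : lo ^ 2 ≤ τ := by
      rw [hlo, div_pow, div_le_iff₀ (by positivity)]
      nlinarith
    -- facts on the domain
    have hdom : ∀ x ∈ r₁.domain, ((lo : ℝ) ≤ x 0 ∧ x 0 ≤ ((1 : ℚ) : ℝ)) ∧ 0 < x 0 ∧
        (a : ℝ) * ζ x ^ 2 + c = ((-c * κ₀ / κ₁ : ℚ) : ℝ) / x 0 ^ 2 := by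
      intro x hx
      have hxS := hr₁ hx
      obtain ⟨ht0, ht1⟩ := hS01 x hxS
      obtain ⟨hz, hz1⟩ := hζ x hxS
      have h := hrel x hxS
      have p1 : 0 ≤ (a : ℝ) * κ₁ * x 0 ^ 2 * (1 - ζ x ^ 2) := mul_nonneg (by positivity) (by linarith)
      have p2 : 0 ≤ -(c : ℝ) * (κ₁ * x 0 ^ 2) := mul_nonneg (by linarith) (by positivity)
      have ht2 : ((τ : ℚ) : ℝ) ≤ x 0 ^ 2 := by
        rw [hτ]
        push_cast
        rw [div_le_iff₀ (by positivity)]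
        linarith
      have htlo : (lo : ℝ) ≤ x 0 := by
        refine not_lt.1 fun hlt => ?_
        have h8 : x 0 * x 0 < (lo : ℝ) * lo := mul_self_lt_mul_self ht0 hlt
        have h9 : ((lo : ℚ) : ℝ) ^ 2 ≤ ((τ : ℚ) : ℝ) := by exact_mod_cast hlo2
        rw [sq] at h9
        rw [sq] at ht2
        linarith
      have htpos : 0 < x 0 := lt_of_lt_of_le (by exact_mod_cast hlopos) htlo
      refine ⟨⟨htlo, by push_cast; exact ht1⟩, htpos, ?_⟩
      have key : ((a : ℝ) * ζ x ^ 2 + c) * x 0 ^ 2 * κ₁ = -c * κ₀ := by linear_combination h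
      rw [eq_div_iff (pow_ne_zero 2 htpos.ne')]
      push_cast
      field_simp
      linear_combination key
    refine InBaker.sqrt_const_LW (-c * κ₀ / κ₁) hMpos hκ' 1 0 1 one_ne_zero
      (Polynomial.C (γ * (-c * κ₀ / κ₁) / (3 * a))) lo 1 (fun x hlx _ => ?_) r₁
      (fun v hv => (hdom v hv).1) (fun v hv => hS01 v (hr₁ hv)) fun v hv => ?_
    · have : (0 : ℝ) < x := lt_of_lt_of_le (by exact_mod_cast hlopos) hlx
      push_cast
      linarith
    · obtain ⟨-, ht, hM⟩ := hdom v hv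
      have hv' : v ∈ r₁.domain := hv
      have hW0 : (κ₀ : ℝ) + κ₁ * v 0 ^ 2 ≠ 0 := by positivity
      have hM0 : (0 : ℝ) ≤ ((-c * κ₀ / κ₁ : ℚ) : ℝ) := by exact_mod_cast hMpos.le
      rw [hint hv']
      beta_reduce
      rw [ppot, s0, s1, ph, hM, Real.sqrt_div' _ (sq_nonneg _), Real.sqrt_sq ht.le]
      simp only [Polynomial.aeval_C, map_add, map_mul, map_pow, Polynomial.aeval_X, eq_ratCast, qD]
      push_cast
      field_simp
      ring
  · -- `c = 0`: the null slope `t = 0`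
    subst hc
    refine InBaker.of_subset_zeroSet r₁ (X 0 : MvPolynomial (Fin 1) ℚ) ⟨fun _ => 1, by simp⟩
      fun v hv => ?_
    have hxS := hr₁ hv
    obtain ⟨hz, -⟩ := hζ v hxS
    have h := hrel v hxS
    simp only [Rat.cast_zero, zero_mul, add_zero] at h
    have ht : v 0 = 0 := by
      rcases mul_eq_zero.1 h with h3 | h3
      · rcases mul_eq_zero.1 h3 with h4 | h4
        · exfalso
          rcases mul_eq_zero.1 h4 with h5 | h5
          · exact ha' h5
          · exact hκ1.ne' h5
        · exfalso
          exact hz.ne' (pow_eq_zero_iff two_ne_zero |>.1 h4)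
      · exact pow_eq_zero_iff two_ne_zero |>.1 h3
    simpa using ht
  · -- `c > 0`: the section is empty
    have hc' : (0 : ℝ) < c := by exact_mod_cast hc
    refine InBaker.of_domain_eq_empty r₁ (Set.subset_empty_iff.1 fun v hv => ?_)
    exfalso
    have hxS := hr₁ hv
    have h := hrel v hxS
    have p1 : 0 ≤ (a : ℝ) * κ₁ * ζ v ^ 2 * v 0 ^ 2 := by positivity
    have p2 : 0 < (c : ℝ) * (κ₀ + κ₁ * v 0 ^ 2) := by positivity
    linarith

/-! #### 61.2 The centre on the wall conic: `q₀² = c` -/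

/-- **THE CENTRE ON THE WALL CONIC** (`k = aκ₀ − q₁² ≠ 0`, `q₀² = c`).  In the slope chart the wall is
`X·(aW(t) − u(t)²) = 2q₀u(t)` with `u = q₁ + q₂t`, `W = κ₀ + κ₁t²`.  `q₀ = 0`: the section lies on the null set
`aW = u²` (a non-zero polynomial, constant coefficient `k`).  `q₀ ≠ 0`: `aW − u² ≠ 0` on the section, the wall is
rationally parametrised, `Λ = q₀(aW + u²)/(aW − u²)` and the primitive `γ/(3a)·Λ²|Λ|/W` is a rational function
up to the sign of `Λ` (`InBaker.abs_of_signed`, `InBaker.of_isRatOn`). [KontsevichZagier2001 §1.2; this node] -/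
theorem InBaker.psection_centre (hκ : 0 < κ₀ ∧ 0 < κ₁) (γ a c : ℚ) (ha : a ≠ 0) (q : Wall)
    (hk : a * κ₀ - q.k1 ^ 2 ≠ 0) (hc : q.k0 ^ 2 = c)
    {S : Set (Fin 1 → ℝ)} (ζ : (Fin 1 → ℝ) → ℝ)
    (hζ : ∀ x ∈ S, 0 < ζ x ∧ ζ x ^ 2 ≤ 1)
    (hwall : ∀ x ∈ S, (a : ℝ) * ζ x ^ 2 + c =
      (q.k0 + (q.k1 + q.k2 * x 0) * (ζ x / pN κ₀ κ₁ (x 0))) ^ 2)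
    (r₁ : KZ.IntegralRep 1) (hr₁ : r₁.domain ⊆ S)
    (hint : EqOn r₁.integrand (fun x => ppot κ₀ κ₁ γ a c (Fin.snoc x (ζ x))) r₁.domain) :
    InBaker (KZ.of r₁) := by
  have hκ' : 0 < κ₀ ∧ 0 ≤ κ₁ := ⟨hκ.1, hκ.2.le⟩
  have hκ0 : (0 : ℝ) < κ₀ := by exact_mod_cast hκ.1
  have hκ1 : (0 : ℝ) < κ₁ := by exact_mod_cast hκ.2
  have ha' : (a : ℝ) ≠ 0 := by exact_mod_cast ha
  have s0 : ∀ (x : Fin 1 → ℝ) (t : ℝ), (Fin.snoc x t : Fin 2 → ℝ) 0 = x 0 := fun _ _ => rfl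
  have s1 : ∀ (x : Fin 1 → ℝ) (t : ℝ), (Fin.snoc x t : Fin 2 → ℝ) 1 = t := fun _ _ => rfl
  have hc' : (c : ℝ) = (q.k0 : ℝ) ^ 2 := by exact_mod_cast hc.symm
  -- the wall in the slope chart: `X·(aW − u²) = 2q₀u`
  have hrel : ∀ x ∈ S, ζ x / pN κ₀ κ₁ (x 0) *
      ((a : ℝ) * (κ₀ + κ₁ * x 0 ^ 2) - (q.k1 + q.k2 * x 0) ^ 2) = 2 * q.k0 * (q.k1 + q.k2 * x 0) := by
    intro x hx
    have hN := pN_pos hκ' (x 0)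
    have hN2 := pN_sq hκ' (x 0)
    obtain ⟨hz, -⟩ := hζ x hx
    have hw := hwall x hx
    rw [hc'] at hw
    have hXpos : 0 < ζ x / pN κ₀ κ₁ (x 0) := div_pos hz hN
    have hXN : ζ x ^ 2 = (ζ x / pN κ₀ κ₁ (x 0)) ^ 2 * (κ₀ + κ₁ * x 0 ^ 2) := by
      rw [← hN2, div_pow, div_mul_cancel₀ _ (pow_ne_zero 2 hN.ne')]
    rw [hXN] at hw
    generalize ζ x / pN κ₀ κ₁ (x 0) = X at hw hXpos ⊢
    have h3 : X * (X * ((a : ℝ) * (κ₀ + κ₁ * x 0 ^ 2) - (q.k1 + q.k2 * x 0) ^ 2) -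
        2 * q.k0 * (q.k1 + q.k2 * x 0)) = 0 := by
      linear_combination hw
    rcases mul_eq_zero.1 h3 with h4 | h4
    · exact absurd h4 hXpos.ne'
    · linear_combination h4
  by_cases hk0 : q.k0 = 0
  · -- `q₀ = 0 = c`: the section lies on the null set `aW(t) = u(t)²`
    refine InBaker.of_subset_zeroSet r₁
      (C (a * κ₀ - q.k1 ^ 2) + C (-(2 * q.k1 * q.k2)) * X 0 + C (a * κ₁ - q.k2 ^ 2) * X 0 ^ 2 :
        MvPolynomial (Fin 1) ℚ) ⟨fun _ => 0, ?_⟩ fun v hv => ?_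
    · simp only [map_add, map_mul, map_neg, map_pow, MvPolynomial.aeval_C, MvPolynomial.aeval_X,
        eq_ratCast]
      norm_num
      exact_mod_cast hk
    · have hxS := hr₁ hv
      obtain ⟨hz, -⟩ := hζ v hxS
      have hN := pN_pos hκ' (v 0)
      have h := hrel v hxS
      rw [hk0, Rat.cast_zero, mul_zero, zero_mul] at h
      rcases mul_eq_zero.1 h with h4 | h4
      · exact absurd h4 (div_pos hz hN).ne'
      · simp only [map_add, map_mul, map_neg, map_pow, MvPolynomial.aeval_C, MvPolynomial.aeval_X,
          eq_ratCast]
        push_cast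
        linear_combination h4
  -- `q₀ ≠ 0`: the rational parametrisation
  have hk0' : (q.k0 : ℝ) ≠ 0 := by exact_mod_cast hk0
  have hD : ∀ x ∈ S, (a : ℝ) * (κ₀ + κ₁ * x 0 ^ 2) - (q.k1 + q.k2 * x 0) ^ 2 ≠ 0 := by
    intro x hx hD0
    have h := hrel x hx
    rw [hD0, mul_zero] at h
    have hu : (q.k1 : ℝ) + q.k2 * x 0 = 0 := by
      rcases mul_eq_zero.1 h.symm with h5 | h5
      · exfalso
        rcases mul_eq_zero.1 h5 with h6 | h6
        · norm_num at h6
        · exact hk0' h6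
      · exact h5
    rw [hu] at hD0
    have hW := pW_pos hκ' (x 0)
    rw [pW] at hW
    have : (a : ℝ) * (κ₀ + κ₁ * x 0 ^ 2) = 0 := by linear_combination hD0
    rcases mul_eq_zero.1 this with h7 | h7
    · exact ha' h7
    · exact hW.ne' h7
  obtain ⟨Λ, hΛdef⟩ : ∃ Λ : (Fin 1 → ℝ) → ℝ, Λ = fun v => (q.k0 : ℝ) *
      ((a : ℝ) * (κ₀ + κ₁ * v 0 ^ 2) + (q.k1 + q.k2 * v 0) ^ 2) /
        ((a : ℝ) * (κ₀ + κ₁ * v 0 ^ 2) - (q.k1 + q.k2 * v 0) ^ 2) := ⟨_, rfl⟩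
  have hΛ : ∀ x ∈ S, (q.k0 : ℝ) + (q.k1 + q.k2 * x 0) * (ζ x / pN κ₀ κ₁ (x 0)) = Λ x := by
    intro x hx
    have hDx := hD x hx
    have hX : ζ x / pN κ₀ κ₁ (x 0) = 2 * q.k0 * (q.k1 + q.k2 * x 0) /
        ((a : ℝ) * (κ₀ + κ₁ * x 0 ^ 2) - (q.k1 + q.k2 * x 0) ^ 2) := by
      rw [eq_div_iff hDx]
      exact hrel x hx
    rw [hΛdef]
    beta_reduce
    rw [hX, eq_div_iff hDx, add_mul, ← mul_div_assoc, div_mul_cancel₀ _ hDx]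
    ring
  have hph : ∀ x ∈ S, ph a c (ζ x) = Λ x ^ 2 * |Λ x| := fun x hx => by
    rw [ph, hwall x hx, hΛ x hx, Real.sqrt_sq_eq_abs]
  -- rationality
  have hW0 : ∀ v ∈ r₁.domain, (κ₀ : ℝ) + κ₁ * v 0 ^ 2 ≠ 0 := fun v _ => by positivity
  have hWr : IsRatOn r₁.domain fun v => (κ₀ : ℝ) + κ₁ * v 0 ^ 2 :=
    (IsRatOn.const κ₀).add ((IsRatOn.const κ₁).mul (IsRatOn.coord.pow 2))
  have hur : IsRatOn r₁.domain fun v => (q.k1 : ℝ) + q.k2 * v 0 :=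
    (IsRatOn.const q.k1).add ((IsRatOn.const q.k2).mul IsRatOn.coord)
  have hΛr : IsRatOn r₁.domain Λ := by
    rw [hΛdef]
    exact ((IsRatOn.const q.k0).mul (((IsRatOn.const a).mul hWr).add (hur.pow 2))).div
      (((IsRatOn.const a).mul hWr).sub (hur.pow 2)) fun v hv => hD v (hr₁ hv)
  have hFr : IsRatOn r₁.domain fun v =>
      ((γ / (3 * a) : ℚ) : ℝ) * Λ v ^ 2 / (κ₀ + κ₁ * v 0 ^ 2) :=
    ((IsRatOn.const (γ / (3 * a))).mul (hΛr.pow 2)).div hWr hW0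
  refine InBaker.abs_of_signed r₁
    (fun v => ((γ / (3 * a) : ℚ) : ℝ) * Λ v ^ 2 / (κ₀ + κ₁ * v 0 ^ 2)) Λ
    (hΛr.isSemialgebraicFunOn r₁.isSemialgebraic_domain) (fun v hv => ?_) fun s _ r' hr' hr'i => ?_
  · rw [hint hv]
    beta_reduce
    rw [ppot, s0, s1, hph v (hr₁ hv)]
    push_cast
    ring
  · exact InBaker.of_isRatOn r' ((((IsRatOn.const s).mul hFr).mul hΛr).mono hr') hr'i

end Summit.KontsevichZagierPeriods.RootDecompWalshStrata.ConicDescent.BallCube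

end
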